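import Summits.QuantumFields.YangMills.Theorems.BalabanUVNodesN08AlphaClassI

/-!
# Route «BalabanUVNodes», Track-A DAG node N08 = [Balaban1985UV3] Thm 1 p. 257 ∕ Thm 2 p. 272 — THE (α) CLAUSE OF THE d = 3 LANE: THE LOAD MAP OF
# THE CLUSTER-EXPANSION DATA SCHEMA AT ZERO EXPANSION DATA (part 1 of 2: THE ZERO DATA) — the zero step series `zeroSeries` of
# `Carriers.StepSeries`, its DEFINED pieces (all `0`), the zero auxiliary data `zeroAlpha` (G3D-07∕08 binders at zero pieces), the zero (43)-sizes

Cell `pub-ymgap`, seat `pub-ymgap-dag-n08-d` gen 6 (director-ym R134 row «CLASS-I in-edge conclusions at the (α) granularity of `RunAlpha`: type the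
cluster-expansion DATA (41)∕(47) as hypothesis schema and discharge the species-OK interfaces»; dag-lead NODE-TABLE v40 «seat n08-d free → successor on
the DATA schema»).  `bears_on: R4∕N08`; filed `--supports stmt-QuantumFields-20290 --as helper` (K1⁗).  Sorry-free, standard axioms, docstring on
every declaration.  DEFINITIONS of explicit TEST DATA (the zero series and its companions) + kernel lemmas about them; nothing of the paper is asserted.

WHY.  After gens 0–5 the in-edge side (class I) of the lane's (α) clause `UVStability3DInputs.RunAlpha 𝔊 𝔠 X 𝔖 𝔄` is EMPTY of record (gen 5
`…ProfileSUEnd.b10_main_at_record_of_dataPin_su_bump`) and what stays displayed is the DATA SCHEMA `BalabanUVNodesN08AlphaClassI.RunDataRows` — per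
step the 21-row `StepDataRows k` (G3D-01∕02∕04∕05∕06 binders, (26), (28), [B1] (3.24)(a)(c), the identifications `hPY`∕`hPYZ`∕`hact`, measure ∕ box ∕
potential regularity, `Pint` measurable and bounded, and the two RESIDUAL rows R3D-01 `fibre49` ∕ R3D-02 `fibre57Low`) + (43)'s form.  The chair's R434
(c1) idiom reads it as «ESTIMATE ASSUMED AS ADMISSIBILITY; non-vacuous instances need `RunDataRows`».  This two-part module LOCATES the schema's content
by the refuter's vacuity angle (lane LEAF-LEDGER §E «non-vacuity witnesses», at the INPUT level this time): WHICH rows can tell Bałaban's expansion from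
NO expansion at all?  Answer (part 2, `…N08AlphaZeroDataRows`): only the residual pair — every other row of `StepDataRows`, the (43)-form and the class-I
step rows `h44`∕`hfloor` HOLD for the zero data of this file, for ANY external inputs `X`.

CONTENTS (part 1).
* §1 `zeroGraphTerms` (the empty G3D-02 carrier) and ★ `zeroSeries S G V N k : Carriers.StepSeries S G V N k` — charts `Ψ ≡ 0`, chart configurations
  `B ≡ 0`, far terms `0`, `PY = PYZ ≡ 0`, no previous-scale terms, the one-point fluctuation space with the Dirac law, box `univ`, `𝒱 ≡ 0`, no Gaussian
  variables in (63); its DEFINED pieces vanish: `zeroSeries_logZU ∕ _logZ1 ∕ _logZT` (`gaussLog_of_isEmpty`: `log ∫_{ℝ⁰} 1 = 0`), `_logFl`, `_act`,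
  `_cum` (the printed cumulants of the zero potential under the Dirac law: `cgf ≡ 0`).
* §2 at the lane's types (`𝔤ᶜ`-valued charts on `nblkOf` blocks): `zeroRun 𝔊 𝔠`; `inputOf_zeroRun_Pint` (the interaction sum (43) of the lane's tower
  input VANISHES); the zero (63)-localisation `zeroLocalized` (G3D-07 at zero pieces: empty telescope, G3D-01 for the zero chart, (26) by `rfl`, G3D-06
  iff its right side is nonnegative — hypothesis `hfar`, automatic on the run `g_k ≤ 1` by `farCurrency_nonneg_of_le_one`, a sign condition on the
  record alone at the steps `k ≥ K` that `AlphaData` also carries but the run never reads); ★ `zeroAlpha` (`UVStability3DInputs.AlphaData` at zero data: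
  G3D-08 with the record's `C45` since the jet of the zero piece vanishes, `Bv = cP ≡ 0`, zero (23)-constants); `zeroSizes` (coefficient and loop sizes of
  (43) `≡ 0`).
HONEST FRAMING: count-neutral kernel TEST DATA for an audit of the lane's hypothesis schema; the zero series is NOT Bałaban's expansion and nothing here
claims it satisfies the residual rows (part 2 shows where the content sits); N08 NOT discharged; d = 3 lattice gauge theory on finite tori as printed;
nothing about d = 4, the continuum, OS axioms, a mass gap or the Clay problem.
-/

noncomputable section

namespace Summit.QuantumFields.YangMills.Theorems.BalabanUVNodesN08AlphaZeroData

open MeasureTheory ProbabilityTheory Metric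
open scoped BigOperators Matrix
open Literature.MathematicalPhysics.QuantumFieldTheory.Balaban1983to89
open Literature.MathematicalPhysics.QuantumFieldTheory.Balaban1983to89.B10
open Literature.MathematicalPhysics.QuantumFieldTheory.Balaban1983to89.B10SectCExpansion (Shape43 Bound44 TermSizes)
open Literature.MathematicalPhysics.QuantumFieldTheory.Balaban1983to89.B10Eq24Cumulant (chiMeasure truncExp)
open Literature.MathematicalPhysics.QuantumFieldTheory.Balaban1983to89.TreeLengthTorus (tsys)
open Literature.MathematicalPhysics.QuantumFieldTheory.Balaban1985CMP102
open Literature.MathematicalPhysics.QuantumFieldTheory.Balaban1985CMP102.Setting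
open Literature.MathematicalPhysics.QuantumFieldTheory.Balaban1985CMP102.Binders
  (ChartAnalyticityAsCited FarTermsDecayAsCited Norm35StepAsCited LogZTExtensiveAsCited LogZTModel GraphRep23AsCited GraphTerms
    LogZLocalizedAsCited)
open Literature.MathematicalPhysics.QuantumFieldTheory.Balaban1985CMP102.BindersNewborn (NewbornTerms45AsCited)
open Summit.QuantumFields.Balaban3D.Carriers
open Summit.QuantumFields.Balaban3D.Proofs.Inputs
open Summit.QuantumFields.Balaban3D.Proofs.Primitives (AlphaConsts)
open Summit.QuantumFields.Balaban3D.Proofs.GroupModelLieC (lieC)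
open Summit.QuantumFields.Balaban3D.Proofs.UVStability3DInputs
open Summit.QuantumFields.Balaban3D.Proofs.Representation33 (jet26 jet26_apply_zero)
open Summit.QuantumFields.Balaban3D.Proofs.Bound55Std (Fibre49 Fibre57Low)
open Summit.QuantumFields.Balaban3D.Proofs.ScalesArithmetic (gk_pos gk_le_one sites_nonneg g0sq_pos)
open Summit.QuantumFields.Balaban3D.Proofs.VacuumAndBooking (rFun_nonneg)
open Summit.QuantumFields.YangMills.Theorems.BalabanUVNodesN08AlphaClassI

variable {L : ℕ}

/-! ## §1 The ZERO step series and its defined pieces -/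

section Zero

variable (S : Scales L) (G : Type) [GaugeGroup G] [MeasurableSpace G] [HaarData G]
  (V : Type) [NormedAddCommGroup V] [NormedSpace ℂ V] (N : ℕ) [NeZero N] (k : ℕ)

/-- The EMPTY graph carrier of G3D-02 (no expressions at all). [folklore] -/
def zeroGraphTerms (D : LocDomainSys) (Cfg : Type) : GraphTerms D Cfg where
  Γ := PEmpty
  supp := ∅
  E := fun γ _ => γ.elim
  loc := fun γ => γ.elim
  nv := fun γ => γ.elim
  pref := fun γ => γ.elim
  lines := fun γ => γ.elim

/-- The empty graph carrier has zero activities. [folklore] -/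
theorem zeroGraphTerms_act {D : LocDomainSys} {Cfg : Type} {_inst : DecidableEq D.Dom}
    (Y : (zeroGraphTerms D Cfg).activities.Poly) (U : (zeroGraphTerms D Cfg).activities.Cfg) :
    (zeroGraphTerms D Cfg).activities.act Y U = 0 := by
  simp [GraphTerms.activities, zeroGraphTerms]

/-- **THE ZERO STEP SERIES** of step `k → k+1`: every expansion datum of `Carriers.StepSeries` set to zero — charts `Ψ ≡ 0`, chart configurations
`B ≡ 0`, far terms `0`, new polymer sums `PY = PYZ ≡ 0`, the empty graph carrier, no previous-scale terms (`Ndeg ≡ 0`, `oldVal ≡ 0`), the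
one-point fluctuation space with the Dirac law, box `= univ`, effective potential `𝒱 ≡ 0`, and NO Gaussian variables in the three representations
(63) (`dimZ ≡ 0`, `dimT = 0`, Jacobian constants `0`). [folklore] -/
def zeroSeries : StepSeries S G V N k where
  Ψ := fun _ _ => 0
  Bcfg := fun _ _ _ => 0
  far := fun _ _ _ => 0
  PY := fun _ _ => 0
  PYZ := fun _ _ => 0
  Gt := fun _ => zeroGraphTerms (tsys 3 N) (GaugeField S.P (k + 1) G)
  Ndeg := fun _ => 0
  oldVal := fun _ _ _ _ _ _ => 0
  Fl := Unit
  μ := Measure.dirac ()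
  box := fun _ => Set.univ
  𝒱 := fun _ _ _ => 0
  dimZ := fun _ => 0
  QU := fun _ _ => 0
  JU := fun _ _ => 0
  Q1 := fun _ => 0
  J1 := fun _ => 0
  dimT := 0
  QT := 0
  JT := 0

variable {S G V N k}

/-- Field of the zero series (`rfl`). [folklore] -/
@[simp] theorem zeroSeries_Ψ (Y : (tsys 3 N).Dom) (b : PBond S.P k → V) : (zeroSeries S G V N k).Ψ Y b = 0 := rfl
/-- Field of the zero series (`rfl`). [folklore] -/
@[simp] theorem zeroSeries_Bcfg (Y : (tsys 3 N).Dom) (h : Hist S.P (k + 1)) (U : GaugeField S.P (k + 1) G) :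
    (zeroSeries S G V N k).Bcfg Y h U = 0 := rfl
/-- Field of the zero series (`rfl`). [folklore] -/
@[simp] theorem zeroSeries_far (Y : (tsys 3 N).Dom) (h : Hist S.P (k + 1)) (U : GaugeField S.P (k + 1) G) :
    (zeroSeries S G V N k).far Y h U = 0 := rfl
/-- Field of the zero series (`rfl`). [folklore] -/
@[simp] theorem zeroSeries_PY (h : Hist S.P (k + 1)) (U : GaugeField S.P (k + 1) G) : (zeroSeries S G V N k).PY h U = 0 := rfl
/-- Field of the zero series (`rfl`). [folklore] -/
@[simp] theorem zeroSeries_PYZ (h : Hist S.P (k + 1)) (U : GaugeField S.P (k + 1) G) : (zeroSeries S G V N k).PYZ h U = 0 := rfl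
/-- Field of the zero series (`rfl`). [folklore] -/
@[simp] theorem zeroSeries_oldVal (h : Hist S.P (k + 1)) (U : GaugeField S.P (k + 1) G) (j : ℕ) (y : Site S.P j) (n : ℕ)
    (c : Fin n → PBond S.P j) : (zeroSeries S G V N k).oldVal h U j y n c = 0 := rfl
/-- Field of the zero series (`rfl`). [folklore] -/
@[simp] theorem zeroSeries_𝒱 (h : Hist S.P (k + 1)) (U : GaugeField S.P (k + 1) G) (ω : (zeroSeries S G V N k).Fl) :
    (zeroSeries S G V N k).𝒱 h U ω = 0 := rfl
/-- Field of the zero series (`rfl`). [folklore] -/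
@[simp] theorem zeroSeries_box (h : Hist S.P (k + 1)) : (zeroSeries S G V N k).box h = Set.univ := rfl
/-- Field of the zero series (`rfl`). [folklore] -/
@[simp] theorem zeroSeries_Gt_supp (h : Hist S.P (k + 1)) : ((zeroSeries S G V N k).Gt h).supp = ∅ := rfl

/-- The Gaussian logarithm of (63) over ZERO variables vanishes: `log ∫_{ℝ⁰} e^{0} = log 1 = 0`. [folklore] -/
theorem gaussLog_of_isEmpty {ι : Type} [Fintype ι] [IsEmpty ι] (Q : Matrix ι ι ℝ) :
    Real.log (∫ v : ι → ℝ, Real.exp (-(1 / 2 : ℝ) * (v ⬝ᵥ Q.mulVec v))) = 0 := by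
  rw [MeasureTheory.volume_pi, Measure.pi_of_empty (x := isEmptyElim), integral_dirac]
  have : (isEmptyElim : ι → ℝ) ⬝ᵥ Q.mulVec isEmptyElim = 0 := by
    simp [dotProduct]
  rw [this, mul_zero, Real.exp_zero, Real.log_one]

/-- `log Z^{(k)}(B(Λ_{k+1}), U_{k+1}) = 0` at zero data. [folklore] -/
@[simp] theorem zeroSeries_logZU (h : Hist S.P (k + 1)) (U : GaugeField S.P (k + 1) G) :
    (zeroSeries S G V N k).logZU h U = 0 := by
  show (0 : ℝ) + StepSeries.gaussLog (0 : Matrix (Fin 0) (Fin 0) ℝ) = 0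
  rw [StepSeries.gaussLog, gaussLog_of_isEmpty, add_zero]

/-- `log Z^{(k)}(B(Λ_{k+1}), 1) = 0` at zero data. [folklore] -/
@[simp] theorem zeroSeries_logZ1 (h : Hist S.P (k + 1)) : (zeroSeries S G V N k).logZ1 h = 0 := by
  show (0 : ℝ) + StepSeries.gaussLog (0 : Matrix (Fin 0) (Fin 0) ℝ) = 0
  rw [StepSeries.gaussLog, gaussLog_of_isEmpty, add_zero]

/-- `log Z^{(k)}(T₁^{(k)}, 1) = 0` at zero data. [folklore] -/
@[simp] theorem zeroSeries_logZT : (zeroSeries S G V N k).logZT = 0 := by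
  show (0 : ℝ) + StepSeries.gaussLog (0 : Matrix (Fin 0) (Fin 0) ℝ) = 0
  rw [StepSeries.gaussLog, gaussLog_of_isEmpty, add_zero]

/-- The fluctuation logarithm of (58) vanishes at zero data: `log ∫_{univ} e^{0} dδ = 0`. [folklore] -/
@[simp] theorem zeroSeries_logFl (h : Hist S.P (k + 1)) (U : GaugeField S.P (k + 1) G) :
    (zeroSeries S G V N k).logFl h U = 0 := by
  show Real.log (∫ ω in (Set.univ : Set Unit), Real.exp ((0 : ℝ)) ∂(Measure.dirac ())) = 0
  rw [Measure.restrict_univ, integral_dirac, Real.exp_zero, Real.log_one]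

/-- The chart activities vanish at zero data. [folklore] -/
@[simp] theorem zeroSeries_act (h : Hist S.P (k + 1)) (X : (tsys 3 N).Dom) (U : GaugeField S.P (k + 1) G) :
    (zeroSeries S G V N k).act h X U = 0 := by
  show ((0 : ℂ)).re = 0
  simp

/-- The box-restricted law at zero data is the Dirac law (`χ ≡ 1`). [folklore] -/
theorem chiMeasure_zeroSeries (h : Hist S.P (k + 1)) :
    chiMeasure (zeroSeries S G V N k).μ (((zeroSeries S G V N k).box h).indicator fun _ => (1 : ℝ)) =
      (Measure.dirac () : Measure Unit) := by
  show chiMeasure (Measure.dirac ()) ((Set.univ : Set Unit).indicator fun _ => (1 : ℝ)) = Measure.dirac ()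
  rw [chiMeasure, Set.indicator_univ]
  simp only [ENNReal.ofReal_one]
  exact withDensity_one

/-- The cumulant generating function of the zero potential under the box law is identically `0` at zero data. [folklore] -/
theorem cgf_zeroSeries (h : Hist S.P (k + 1)) (U : GaugeField S.P (k + 1) G) :
    cgf ((zeroSeries S G V N k).𝒱 h U)
      (chiMeasure (zeroSeries S G V N k).μ (((zeroSeries S G V N k).box h).indicator fun _ => (1 : ℝ))) = fun _ => 0 := by
  rw [chiMeasure_zeroSeries]
  funext t
  show cgf (0 : Unit → ℝ) (Measure.dirac ()) t = 0
  rw [cgf_zero_fun]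
  simp

/-- The printed cumulants `⟨𝒱ⁿ⟩ᵀ` all vanish at zero data. [folklore] -/
@[simp] theorem zeroSeries_cum (h : Hist S.P (k + 1)) (U : GaugeField S.P (k + 1) G) (n : ℕ) :
    (zeroSeries S G V N k).cum h U n = 0 := by
  show truncExp _ _ n = 0
  rw [B10Eq24Cumulant.truncExp_def, cgf_zeroSeries]
  rw [iteratedDeriv_const]
  split_ifs <;> rfl

end Zero

/-! ## §2 The zero data at the lane's types: series, auxiliary data, (43)-sizes -/

/-- `r(g_k)·p(g_k) ≥ 0` on the family `g_k ≤ 1`. [folklore] -/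
theorem rFun_mul_pFun_nonneg {N : ℕ} (𝔠 : AlphaConsts L N) {S : Scales L} {k : ℕ} (hg1 : S.gk k ≤ 1) :
    0 ≤ rFun 𝔠.r₀ (S.gk k) * pFun 𝔠.b₀ 𝔠.p₀ (S.gk k) :=
  mul_nonneg (rFun_nonneg _ _ (gk_pos S k) hg1) (pFun_nonneg _ _ _ 𝔠.b₀_pos.le (gk_pos S k) hg1)


section Lane

variable {S : Scales L} {G : Type} [GaugeGroup G] [MeasurableSpace G] [HaarData G] (𝔊 : GroupModel G) (𝔠 : AlphaConsts L 𝔊.N)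
  (X : ExternalInputs S G)

/-- **THE ZERO SERIES OF THE RUN** at the lane's chart space `𝔤ᶜ` and block counts: `zeroSeries` at every step. [folklore] -/
abbrev zeroRun : ∀ k, StepSeries S G ↥(lieC 𝔊) (nblkOf S 𝔠.lane.carrier k) k :=
  fun k => zeroSeries S G ↥(lieC 𝔊) (nblkOf S 𝔠.lane.carrier k) k

/-- The tower of the zero run runs at the lattice approximation's couplings `g_k` (definitional). [folklore] -/
theorem towerOf_zeroRun_g (k : ℕ) : (towerOf 𝔠.lane X (zeroRun 𝔊 𝔠)).g k = S.gk k := rfl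

/-- `log Z^{(k)}(B(Λ_{k+1}), U_{k+1})` of the lane's pieces vanishes at zero data. [folklore] -/
@[simp] theorem pieces_zeroRun_logZU (k : ℕ) (h : Hist S.P (k + 1)) (U : GaugeField S.P (k + 1) G) :
    (pieces 𝔠.lane X (zeroRun 𝔊 𝔠) k).logZU h U = 0 :=
  zeroSeries_logZU (S := S) (G := G) (V := ↥(lieC 𝔊)) (N := nblkOf S 𝔠.lane.carrier k) h U

/-- `log Z^{(k)}(B(Λ_{k+1}), 1)` of the lane's pieces vanishes at zero data. [folklore] -/
@[simp] theorem pieces_zeroRun_logZ1 (k : ℕ) (h : Hist S.P (k + 1)) :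
    (pieces 𝔠.lane X (zeroRun 𝔊 𝔠) k).logZ1 h = 0 :=
  zeroSeries_logZ1 (S := S) (G := G) (V := ↥(lieC 𝔊)) (N := nblkOf S 𝔠.lane.carrier k) h

/-- `log Z^{(k)}(T₁^{(k)}, 1)` of the lane's pieces vanishes at zero data. [folklore] -/
@[simp] theorem pieces_zeroRun_logZT (k : ℕ) : (pieces 𝔠.lane X (zeroRun 𝔊 𝔠) k).logZT = 0 :=
  zeroSeries_logZT (S := S) (G := G) (V := ↥(lieC 𝔊)) (N := nblkOf S 𝔠.lane.carrier k) (k := k)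

/-- **THE INTERACTION SUM (43) VANISHES AT ZERO DATA**: `Pint k h U = 0` for the lane's tower input over the zero run (no previous-scale terms,
no new polymer sums). [cite: Balaban1985UV3, (43) p.266] -/
@[simp] theorem inputOf_zeroRun_Pint : ∀ (k : ℕ) (h : Hist S.P k) (U : GaugeField S.P k G),
    (inputOf 𝔠.lane X (zeroRun 𝔊 𝔠)).Pint k h U = 0
  | 0, _, _ => rfl
  | k + 1, h, U => by
    show (zeroRun 𝔊 𝔠 k).PoldIn 𝔠.lane.carrier.M₁ (rcolOf S 𝔠.lane.carrier) h U + 0 + 0 = 0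
    rw [add_zero, add_zero, StepSeries.PoldIn, oldSumIn]
    simp

omit [HaarData G] in
/-- The SEVENTH-ORDER CURRENCY `g_k⁷(r(g_k)p(g_k))⁷` of «the last term in (30)» times the record's far∕(63) amplitudes is nonnegative at every
step with `g_k ≤ 1` (so on the whole run of a family member). [cite: Balaban1985UV3, (30) p.263 + p.264 L14–20] -/
theorem farCurrency_nonneg_of_le_one {k : ℕ} (hg1 : S.gk k ≤ 1) :
    0 ≤ 𝔠.Cfar * (𝔠.C63 * (S.gk k ^ 7 * (rFun 𝔠.r₀ (S.gk k) * pFun 𝔠.b₀ 𝔠.p₀ (S.gk k)) ^ 7)) :=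
  mul_nonneg 𝔠.Cfar_nonneg (mul_nonneg 𝔠.C63_nonneg (mul_nonneg (pow_nonneg (gk_pos S k).le _)
    (pow_nonneg (rFun_mul_pFun_nonneg 𝔠 hg1) _)))

/-- **THE ZERO (63)-LOCALISATION** of step `k` (GAP binder G3D-07 at zero data): localized pieces `Ψ ≡ 0`, far monomials `0`; the telescope
`log Z^{(k)}(·, U_{k+1}) − log Z^{(k)}(·, 1) = 0 − 0` is the empty expansion, the chart binder G3D-01 holds for the zero function at the record's radius
and amplitude, (26) is `rfl`, and G3D-06 holds iff its right side is nonnegative (`hfar` — automatic when `g_k ≤ 1`, `farCurrency_nonneg_of_le_one`;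
for the steps `k ≥ K` never read by the run it is a sign condition on the record alone, NECESSARY for any inhabitant of the binder with zero far terms).
[folklore] -/
def zeroLocalized (k : ℕ) (hfar : 0 ≤ 𝔠.Cfar * (𝔠.C63 * (S.gk k ^ 7 * (rFun 𝔠.r₀ (S.gk k) * pFun 𝔠.b₀ 𝔠.p₀ (S.gk k)) ^ 7))) :
    LogZLocalizedAsCited (towerOf 𝔠.lane X (zeroRun 𝔊 𝔠)) k ((zeroRun 𝔊 𝔠) k).E (adjAct 𝔊 (P := S.P) k) 𝔠.ρ 𝔠.r₀ 𝔠.Cfar 𝔠.C63 𝔠.κ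
      (pieces 𝔠.lane X (zeroRun 𝔊 𝔠) k).logZU (pieces 𝔠.lane X (zeroRun 𝔊 𝔠) k).logZ1 ((zeroRun 𝔊 𝔠) k).Bcfg
      (fun h => Finset.univ.filter fun Y : (tsys 3 (nblkOf S 𝔠.lane.carrier k)).Dom =>
        Y.1 ⊆ ΩblkOf 𝔠.lane.carrier.M₁ (rcolOf S 𝔠.lane.carrier) (nblkOf S 𝔠.lane.carrier k) h) where
  Ψ := fun _ _ => 0
  expandDiff := fun h U => by simp
  chart := fun Y => ⟨𝔠.ρ_pos, differentiableOn_const _, fun z _ => by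
    rw [norm_zero]; exact mul_nonneg 𝔠.C63_nonneg (Real.exp_pos _).le⟩
  inv26 := fun _ _ _ _ _ => rfl
  far := fun _ _ _ => 0
  far_le := fun Y h U => by
    rw [abs_zero]
    show 0 ≤ 𝔠.Cfar * (𝔠.C63 * Real.exp (-(𝔠.κ * (tsys 3 (nblkOf S 𝔠.lane.carrier k)).dj Y)) *
      (S.gk k ^ 7 * (rFun 𝔠.r₀ (S.gk k) * pFun 𝔠.b₀ 𝔠.p₀ (S.gk k)) ^ 7))
    have : 𝔠.Cfar * (𝔠.C63 * Real.exp (-(𝔠.κ * (tsys 3 (nblkOf S 𝔠.lane.carrier k)).dj Y)) *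
        (S.gk k ^ 7 * (rFun 𝔠.r₀ (S.gk k) * pFun 𝔠.b₀ 𝔠.p₀ (S.gk k)) ^ 7)) =
        Real.exp (-(𝔠.κ * (tsys 3 (nblkOf S 𝔠.lane.carrier k)).dj Y)) *
          (𝔠.Cfar * (𝔠.C63 * (S.gk k ^ 7 * (rFun 𝔠.r₀ (S.gk k) * pFun 𝔠.b₀ 𝔠.p₀ (S.gk k)) ^ 7))) := by ring
    rw [this]
    exact mul_nonneg (Real.exp_pos _).le hfar

/-- **THE ZERO AUXILIARY DATA** (`UVStability3DInputs.AlphaData` at zero data): the zero (63)-localisation at every step, G3D-08 with the record's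
constant `C45` (the jet of the zero piece vanishes), box bound `Bv ≡ 0`, interaction bound `cP ≡ 0`, zero G3D-02 constants.  Hypothesis `hfar`: the
far currency of G3D-06 is nonnegative at EVERY step — `AlphaData` carries the (63)-binder at all `k : ℕ`, also beyond the run; on the run (`g_k ≤ 1`) it is
automatic (`farCurrency_nonneg_of_le_one`). [folklore] -/
def zeroAlpha (hfar : ∀ k, 0 ≤ 𝔠.Cfar * (𝔠.C63 * (S.gk k ^ 7 * (rFun 𝔠.r₀ (S.gk k) * pFun 𝔠.b₀ 𝔠.p₀ (S.gk k)) ^ 7))) :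
    AlphaData 𝔊 𝔠 X (zeroRun 𝔊 𝔠) where
  Λc := fun k => zeroLocalized 𝔊 𝔠 X k (hfar k)
  N45 := fun k =>
    { C45_nonneg := 𝔠.C45_nonneg
      jet45 := fun Y h U => by
        have h0 : (∑ n ∈ Finset.Ico 2 7, ((n.factorial : ℂ)⁻¹ •
            iteratedFDeriv ℂ n ((zeroLocalized 𝔊 𝔠 X k (hfar k)).Ψ Y) 0 fun _ => ((zeroRun 𝔊 𝔠) k).Bcfg Y h U)) = 0 := by
          show jet26 (fun _ : ((zeroRun 𝔊 𝔠) k).E => (0 : ℂ)) (0 : ((zeroRun 𝔊 𝔠) k).E) = 0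
          exact jet26_apply_zero _
        rw [h0]
        show |(0 : ℂ).re - 0| ≤ _
        rw [Complex.zero_re, sub_zero, abs_zero]
        exact mul_nonneg (mul_nonneg 𝔠.C45_nonneg (sq_nonneg _)) (mul_nonneg 𝔠.C63_nonneg (Real.exp_pos _).le) }
  Bv := fun _ => 0
  cP := fun _ => 0
  C₂₃ := fun _ => 0
  c₂₃ := fun _ => 0
  M₂₃ := fun _ => 0
  δ₀ := fun _ => 0

/-- **THE ZERO SIZES OF (43)**: coefficient sizes `|𝒫_j(Y_j)| ≡ 0` and loop sizes `|B_k(c)| ≡ 0`. [folklore] -/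
def zeroSizes (S : Scales L) (G : Type) : OldTermSizes S G where
  coef := fun _ _ _ _ => fun _ _ _ => 0
  loop := fun _ _ _ _ _ _ => 0

/-- Field of the zero localisation (`rfl`). [folklore] -/
@[simp] theorem zeroAlpha_Λc_Ψ (hfar : ∀ k, 0 ≤ 𝔠.Cfar * (𝔠.C63 * (S.gk k ^ 7 * (rFun 𝔠.r₀ (S.gk k) * pFun 𝔠.b₀ 𝔠.p₀ (S.gk k)) ^ 7)))
    (k : ℕ) (Y : (tsys 3 (nblkOf S 𝔠.lane.carrier k)).Dom)
    (b : ((zeroRun 𝔊 𝔠) k).E) : ((zeroAlpha 𝔊 𝔠 X hfar).Λc k).Ψ Y b = 0 := rfl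

/-- Field of the zero localisation (`rfl`). [folklore] -/
@[simp] theorem zeroAlpha_Λc_far (hfar : ∀ k, 0 ≤ 𝔠.Cfar * (𝔠.C63 * (S.gk k ^ 7 * (rFun 𝔠.r₀ (S.gk k) * pFun 𝔠.b₀ 𝔠.p₀ (S.gk k)) ^ 7)))
    (k : ℕ) (Y : (tsys 3 (nblkOf S 𝔠.lane.carrier k)).Dom)
    (h : Hist S.P (k + 1)) (U : GaugeField S.P (k + 1) G) : ((zeroAlpha 𝔊 𝔠 X hfar).Λc k).far Y h U = 0 := rfl

end Lane

end Summit.QuantumFields.YangMills.Theorems.BalabanUVNodesN08AlphaZeroData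

end
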